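import Summits.QuantumFields.GaugeBoot.ZdWalkWords
import Summits.QuantumFields.GaugeBoot.HaarShiftPlaquetteSignAllReps
import HarnessLib

/-!
# No non-trivial reduced loop VARIABLE is identically `1` over `SU(N)`, `N ≥ 2` (gauge-boot, large-`N` supplement 16, part 4)

HONEST FRAMING (cell `pub-gaugeboot`, page 1 of every file): the venture produces certified bounds
on lattice expectations at stated coupling, gauge group, dimension and torus size; NOT a mass gap,
NOT a continuum limit, NOT a string tension; NOT large `N` unless marked CONDITIONAL; NOT
Yang–Mills-summit-bearing (barriers `FixedCouplingUltralocality`, `PerturbativeInvisibility`).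
Group theory and lattice combinatorics; this file certifies no number.

## Content

Parts 1–3 are statements about HOLONOMIES; the bootstrap's unknowns are the LOOP VARIABLES
`W_x(w)(U) = (1/N) Re tr hol_x(w)(U)` (`wordLoopZd (suRep N)`), with the a-priori bound `|W| ≤ 1`
(`abs_wordLoopZd_le_one`).  For `SU(N)` in the fundamental representation `W = 1 ⟺ hol = 1`
(`wordLoopZd_suRep_eq_one_iff`, from the lane's `eq_one_of_re_trace_eq_card`), so:

* ★★ `exists_config_wordLoopZd_lt_one` — for `N ≥ 2`, EVERY non-empty reduced word has a configuration
  with `W_x(w) < 1`; `eq_nil_of_forall_wordLoopZd_eq_one` — **a reduced word whose loop variable is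
  identically `1` over `SU(N)` is the empty word** (the bound `y_v ≤ 1` of the certificates is attained
  identically only at `v = ∅`); cyclically reduced form; ★ `exists_config_wilsonLoopTrace_re_lt` — the
  same for Shen–Zhu–Zhu's `wilsonLoopTrace` of a non-backtracking closed walk (`Re W_ℓ < N` somewhere).
* `lift_blockEmb_genNat_fin_injective` — the `d` axis holonomies of the free configuration generate a
  free group of rank `d` in `SU(2+k)` (`FreeGroup (Fin d) ↪ SU(2+k)`).

NOT claimed: distinct reduced words need NOT have distinct loop variables (`W(w) = W(w⁻¹)`, cyclic
shifts, and for `SU(2)` more coincidences); nothing about `N = 1`.  [folklore].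
-/

noncomputable section

open SimpleGraph
open Literature.Probability.LatticeModels (Site zdGraph)
open Literature.MathematicalPhysics.QuantumLattice
open Literature.MathematicalPhysics.QuantumFieldTheory (IsNonBacktrackingLoop wilsonLoopTrace wilsonLoopTrace_apply)

namespace Summit.QuantumFields.GaugeBoot

variable {d N : ℕ}

/-! ## `W = 1 ⟺ hol = 1` for `SU(N)` -/

/-- For `V ∈ SU(N)`, `N ≥ 1`: `Re tr V = N ⟺ V = 1` (the lane's `eq_one_of_re_trace_eq_card` for the
fundamental representation, which is injective). [folklore] -/
theorem re_trace_suRep_eq_iff (V : SU N) : ((suRep N V).trace).re = N ↔ V = 1 := by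
  refine ⟨fun h => ?_, fun h => by rw [h, map_one, Matrix.trace_one, Fintype.card_fin, Complex.natCast_re]⟩
  exact fundamentalRep_injective (Fin N) ((eq_one_of_re_trace_eq_card (suRep N) (continuous_suRep N) V h).trans (map_one _).symm)

/-- **The `SU(N)` loop variable of a word equals `1` iff its holonomy is `1`** (`N ≥ 1`). [folklore] -/
theorem wordLoopZd_suRep_eq_one_iff (hN : N ≠ 0) (x : Site d) (w : Word d) (U : LGConfig d (SU N)) :
    wordLoopZd (suRep N) x w U = 1 ↔ wordHolonomyZd U x w = 1 := by
  have hN' : (N : ℝ) ≠ 0 := Nat.cast_ne_zero.2 hN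
  rw [wordLoopZd_apply, ← re_trace_suRep_eq_iff, inv_mul_eq_iff_eq_mul₀ hN', mul_one]

/-- The `SU(N)` loop variable is `< 1` iff the holonomy is `≠ 1` (`N ≥ 1`). [folklore] -/
theorem wordLoopZd_suRep_lt_one_iff (hN : N ≠ 0) (x : Site d) (w : Word d) (U : LGConfig d (SU N)) :
    wordLoopZd (suRep N) x w U < 1 ↔ wordHolonomyZd U x w ≠ 1 := by
  rw [← not_iff_not, not_lt, Ne, not_not, ← wordLoopZd_suRep_eq_one_iff hN x w U]
  have hle : wordLoopZd (suRep N) x w U ≤ 1 := (le_abs_self _).trans (abs_wordLoopZd_le_one (suRep N) (continuous_suRep N) x w U)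
  exact ⟨fun h => le_antisymm hle h, fun h => h.ge⟩

/-! ## Loop variables of reduced words are not identically `1` -/

/-- ★★ **For `N ≥ 2`, every non-empty reduced word has an `SU(N)` configuration with loop variable `< 1`**
(indeed the free configuration of part 2). [folklore] -/
theorem exists_config_wordLoopZd_lt_one (hN : 2 ≤ N) (x : Site d) {w : Word d} (hw : w ≠ [])
    (hred : w.IsChain (fun s t => t ≠ s.inv)) : ∃ U : LGConfig d (SU N), wordLoopZd (suRep N) x w U < 1 := by
  obtain ⟨U, hU⟩ := exists_config_wordHolonomyZd_ne_one hN x hw hred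
  exact ⟨U, (wordLoopZd_suRep_lt_one_iff (by omega) x w U).2 hU⟩

/-- The same for the lane's cyclically reduced (in particular closed, non-empty) loop words. [folklore] -/
theorem exists_config_wordLoopZd_lt_one_of_cyclicallyReduced (hN : 2 ≤ N) (x : Site d) {w : Word d}
    (hw : w.CyclicallyReduced) : ∃ U : LGConfig d (SU N), wordLoopZd (suRep N) x w U < 1 :=
  exists_config_wordLoopZd_lt_one hN x hw.1 hw.2.left_of_append

/-- ★★ **A reduced word whose `SU(N)` loop variable is identically `1` (`N ≥ 2`) is the empty word**: the
a-priori bound `W ≤ 1` of the certificates is attained identically only by the trivial loop. [folklore] -/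
theorem eq_nil_of_forall_wordLoopZd_eq_one (hN : 2 ≤ N) (x : Site d) {w : Word d} (hred : w.IsChain (fun s t => t ≠ s.inv))
    (h : ∀ U : LGConfig d (SU N), wordLoopZd (suRep N) x w U = 1) : w = [] := by
  by_contra hw
  obtain ⟨U, hU⟩ := exists_config_wordLoopZd_lt_one hN x hw hred
  exact (lt_irrefl _) ((h U).symm ▸ hU : (1 : ℝ) < 1)

/-- For comparison: the empty word has loop variable identically `1` (`N ≥ 1`). [folklore] -/
theorem wordLoopZd_nil_eq_one (hN : N ≠ 0) (x : Site d) (U : LGConfig d (SU N)) : wordLoopZd (suRep N) x [] U = 1 :=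
  (wordLoopZd_suRep_eq_one_iff hN x [] U).2 (wordHolonomyZd_nil U x)

/-- ★ **Walk form (Shen–Zhu–Zhu's variable)**: for `N ≥ 2` every non-backtracking closed walk has an
`SU(N)` configuration with `Re W_ℓ = Re tr(hol) < N`. [folklore] -/
theorem exists_config_wilsonLoopTrace_re_lt (hN : 2 ≤ N) {x : Site d} (γ : (zdGraph d).Walk x x) (hγ : IsNonBacktrackingLoop γ) :
    ∃ U : LGConfig d (SU N), (wilsonLoopTrace (suRep N) γ U).re < N := by
  obtain ⟨U, hU⟩ := exists_config_walkHolonomy_ne_one_of_isNonBacktrackingLoop hN γ hγ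
  refine ⟨U, lt_of_le_of_ne ?_ fun h => hU ((re_trace_suRep_eq_iff _).1 (by rw [← wilsonLoopTrace_apply]; exact h))⟩
  rw [wilsonLoopTrace_apply]
  have h1 := abs_wordLoopZd_le_one (suRep N) (continuous_suRep N) x (walkWordZd γ) U
  rw [wordLoopZd_apply, wordHolonomyZd_walkWordZd] at h1
  have hN' : (0 : ℝ) < N := by exact_mod_cast (show 0 < N by omega)
  have h2 := (abs_le.1 h1).2
  rw [inv_mul_le_iff₀ hN', mul_one] at h2
  exact h2

/-- **Hence a non-backtracking closed walk's normalised Wilson loop variable is not identically `1`** over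
`SU(N)`, `N ≥ 2`: `∃ U, (1/N) Re W_ℓ(U) ≠ 1`. [folklore] -/
theorem exists_config_wilsonLoopTrace_ne (hN : 2 ≤ N) {x : Site d} (γ : (zdGraph d).Walk x x) (hγ : IsNonBacktrackingLoop γ) :
    ∃ U : LGConfig d (SU N), (N : ℝ)⁻¹ * (wilsonLoopTrace (suRep N) γ U).re ≠ 1 := by
  obtain ⟨U, hU⟩ := exists_config_wilsonLoopTrace_re_lt hN γ hγ
  have hN' : (N : ℝ) ≠ 0 := by exact_mod_cast (show N ≠ 0 by omega)
  exact ⟨U, fun h => (ne_of_lt hU) (by rwa [inv_mul_eq_iff_eq_mul₀ hN', mul_one] at h)⟩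

/-! ## The axis holonomies of the free configuration generate a free group of rank `d` -/

/-- **`FreeGroup (Fin d) ↪ SU(2+k)`** by the `d` axis holonomies `diag(g_μ, 1)` of the free configuration. [folklore] -/
theorem lift_blockEmb_genNat_fin_injective (d k : ℕ) :
    Function.Injective (FreeGroup.lift fun μ : Fin d => blockEmb k (FreeSU2.genNat μ.val)) := by
  have h : (FreeGroup.lift fun μ : Fin d => blockEmb k (FreeSU2.genNat μ.val)) =
      (FreeGroup.lift fun n => blockEmb k (FreeSU2.genNat n)).comp (FreeGroup.map Fin.val) := by
    ext μ; simp
  rw [h, MonoidHom.coe_comp]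
  exact (lift_blockEmb_genNat_injective k).comp (FreeGroup.map_injective Fin.val_injective)

/-- The link variables of the free configuration ARE these generators: `U_free(x, μ) = diag(g_μ, 1)`. [folklore] -/
theorem freeConfig_apply (d k : ℕ) (e : ZdEdge d) : freeConfig d k e = blockEmb k (FreeSU2.genNat e.2.val) := rfl

end Summit.QuantumFields.GaugeBoot

end
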